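import Summits.HodgeConjecture.HodgeConjecture.Theorems.R90S5MemAPacketOfMultOfCoreLaws      -- ★ (this seat, p862132) `mem_aPacket_of_m_ne_zero_of_coreLaws` (7 core laws) over ★ `R90S5APacketMultOfCoreLaws` (`nComponent_routesToAPacket_of_coreLaws`, 5 routing laws)
import Literature.NumberTheory.Rogawski1990.APacketEigenvalueGerm                           -- ★ `GlobalPacketData.OneDimNotTheta` (Prop. 11.1.1 (a): a one-dimensional `ξ` is not `ρ(θ)`)
import Summits.HodgeConjecture.HodgeConjecture.Theorems.F0P3cDbTEnvelopeTrichotomy         -- ★ brings `MemXiFamily` and the constituent currency of S5 file D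
import HarnessLib

/-!
# R90-TF · S5 «Ch. 13.3» — S5#5 (QS-T) «13.3.6 (c) FINITE TRIGGER» WITH NAMED PINS FROM THE TWELVE LAWS ITS ★ PROOF USES (no 15-law costume)
# — the core-laws twin of ★ `finTriggerMembershipAt_of_laws_of_pins` (p861554, R90-C133-p03), for every inner form `U(H)` (the quasi-split case is `H := qsForm L`)

Cell `hodgecm-mathlib`, crux H413 (`stmt-HodgeConjecture-24833`), route of record `HCCMUnconditional`; programme R90-TF (brief `director/R90-BRIEF.v2.md`
1f40d54518340a35), section S5 = Ch. 13.3 (base `R90-C133`), seat R90-C133-p01 (g0) as S5 JUNCTION ANALYST (interim rule (ii), R90-C133-plan (g0) HANDOFF 1619747b114f2678);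
residual (R7) of the D pay-edition draft `R90/S5/R90-C133-p01/DPay.scratch.lean` (DEAL #18c): p03's ★ composition takes the FIFTEEN-law bundle `𝔨.Laws`, whereas S10 FILE F
delivers NAMED laws only (LEAD #22 J-D2-3 «no 15-hypothesis costume»).  KERNEL FACT (read off the ★ proof terms): (QS-T) consumes exactly TWELVE of the fifteen —
the SEVEN of Thm 13.3.7 (`MainEquality` [Thm 10.3.1 (a)], `MatchTensor` [§4.5], `GermExpansion` [Props 13.5.1, 13.6.1–2], `Separation` [§13.7], `CoeffEndoscopic` [13.7 (3) +
L. 13.6.3], `APacketLift` [Prop 13.2.2 (d)], `LinIndepGerm` [Prop 13.8.1]) through ★ `mem_aPacket_of_m_ne_zero_of_coreLaws`, and the FIVE of the §14.6 ∕ §15.3 routing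
(`PacketTrichotomy` [Thm 13.3.5], `PacketGerm` [§13.3 p. 201], `EvpDichotomyGp` [§14.6 p. 242 ¶2], `StableExclusionGp` [Prop 14.6.2], `EndoscopicExclusionGp` [Thm 14.6.5 +
Thm 13.3.2]) through ★ `nComponent_routesToAPacket_of_coreLaws`; NOT used: `CoeffStable`, `CoeffTheta`, `StablePacketLift`, `MatchSExhaustive`.  Lane `--supports
stmt-HodgeConjecture-24833 --as helper`; ONE theorem, no definition, no instance, no notation, no `sorry`; Lines-free.
HONEST LABEL: HC_CM is proved only modulo the 7 printed citations (2 remaining named inputs: hLiu418 = stmt-HodgeConjecture-24832, h413 = stmt-HodgeConjecture-24833)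
until rung 0 closes; this file proves NO printed global statement outright — it proves print's deduction «a `πⁿ(ξ_v)`-component routes `P` to `Π(ξ′)` and `m(P) ≠ 0` forces
membership» (§15.3 ¶1, §13.10 p. 230) FROM twelve printed relations on a posited datum (each junk-satisfiable ALONE, cert `CertJunkTwistedComparison` bdd77acf197a3ad2) and the named
pins; the content enters at S10 FILE F's concrete datum with its section-socket hypotheses (owners: S6-A∕S8∕S10∕S4 for the seven, S5∕S9∕S7 for the five).

[cite: Rogawski1990, Thm. 13.3.6 (c) p. 202; §13.10 p. 230; Thm. 13.3.7 p. 203; Thm. 13.3.5 p. 202; §14.6 p. 242, Prop. 14.6.2, Thm. 14.6.5 p. 246; §15.3 ¶1 p. 250; Prop. 11.1.1 (a) p. 161]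
[cite: Marshall2014, §3.4]
-/

set_option autoImplicit false
-- the mandated namespace repeats the single-problem summit's segment (`HodgeConjecture.HodgeConjecture`)
set_option linter.dupNamespace false

noncomputable section

open NumberField IsDedekindDomain MeasureTheory
open scoped Matrix ComplexOrder

open Literature.NumberTheory Literature.NumberTheory.Automorphic Literature.NumberTheory.Automorphic.UnitaryGroup
open Literature.NumberTheory.GaloisRepresentations
open Literature.NumberTheory.Rogawski1990
open Summit.HodgeConjecture.HodgeConjecture.Cruxes.H413

namespace Summit.HodgeConjecture.HodgeConjecture.R90.S5

/-- **13.3.6 (c) FINITE TRIGGER WITH NAMED PINS FROM TWELVE NAMED LAWS, at one instance `(L, H, P, v, e, πⁿ)` of an inner form `U(H)`** (quasi-split case: `H := qsForm L`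
with `hH ∕ hHd` the two ★ lemmas): for a twisted-comparison datum `𝔨` satisfying the seven Thm-13.3.7 laws and the five §14.6-routing laws (NAMED, not the 15-law bundle),
the relation `OneDimNotTheta`, and the pins `cls ∕ hPin_m ∕ clsGp ∕ hPin_mGp ∕ hPin_germGp ∕ hPin_n ∕ hPin_memEnv` of ★ `finTriggerMembershipAt_of_laws_of_pins` (token for
token): IF some `v`-constituent of the discrete `P` is `πⁿ ∘ e` THEN `P` lies in the ξ′-envelope ★ `MemXiFamily` of SOME one-dimensional `ξ′`.  Proof = p03's, with
★ `nComponent_routesToAPacket_of_coreLaws` and ★ `mem_aPacket_of_m_ne_zero_of_coreLaws` in place of the `Laws`-bundle lemmas.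
[cite: Rogawski1990, Thm. 13.3.6 (c) p. 202; §13.10 p. 230; Thm. 13.3.7 p. 203; §14.6 p. 242; §15.3 ¶1 p. 250] -/
theorem finTriggerMembershipAt_of_coreLaws_of_pins (L : Type) [Field L] [NumberField L] [IsCMField L] (H : Matrix (Fin 3) (Fin 3) L)
    (hH : (H.map (cmConjRingHom L))ᵀ = H) (hHd : IsUnit H.det) (μω : HeckeCharacter L) (hμu : μω.IsUnitary)
    (μA : Measure (adelicGroupData (↥(maximalRealSubfield L)) L (IsCMField.complexConj L) 3 H).automorphicQuotient)
    [(adelicGroupData (↥(maximalRealSubfield L)) L (IsCMField.complexConj L) 3 H).IsAutomorphicMeasure μA]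
    (P : DiscreteAutomorphicRep (adelicGroupData (↥(maximalRealSubfield L)) L (IsCMField.complexConj L) 3 H) μA)
    (v : HeightOneSpectrum (𝓞 ↥(maximalRealSubfield L)))
    (T : GL (Fin 3) (LocalRing L v)) (a : LocalRing L v) (ha : IsUnit a)
    (h : formCongr (conjLocal L (IsCMField.complexConj L) v) T (H.map (algebraMap L (LocalRing L v))) =
      a • (Matrix.of fun i j : Fin 3 => if i.val + j.val + 1 = 3 then (1 : L) else 0).map (algebraMap L (LocalRing L v)))
    (πn : IrrClass (Gqs L v))
    -- the ★ dictionary datum; the SEVEN Thm-13.3.7 laws; the FIVE §14.6-routing laws; Prop. 11.1.1 (a)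
    {TGt TG TH : Type} (𝔨 : TwistedComparisonData TGt TG TH)
    (h0 : 𝔨.MainEquality) (hT : 𝔨.MatchTensor) (hE : 𝔨.GermExpansion) (hS : 𝔨.Separation) (hCE : 𝔨.CoeffEndoscopic)
    (hAL : 𝔨.APacketLift) (hLI : 𝔨.LinIndepGerm)
    (hTri : 𝔨.𝔊.PacketTrichotomy) (hPG : 𝔨.PacketGerm) (hED : 𝔨.EvpDichotomyGp) (hSX : 𝔨.StableExclusionGp) (hEX : 𝔨.EndoscopicExclusionGp)
    (h1 : 𝔨.𝔊.OneDimNotTheta 𝔨.IsOneDimH)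
    -- PINS (dictionary → record), one named binder each — as in ★ `finTriggerMembershipAt_of_laws_of_pins`
    (cls : 𝔨.𝔊.Rep) (hPin_m : 𝔨.𝔊.m cls ≠ 0)
    (clsGp : 𝔨.RepGp) (hPin_mGp : 𝔨.mGp clsGp ≠ 0) (hPin_germGp : 𝔨.germRep cls = 𝔨.germGp clsGp)
    (hPin_n : (∃ c : IrrClass ((cmDatum L 3 H).Local v),
        (IrrClass.comap (localPiEquiv L (IsCMField.complexConj L) 3 H v) c).IsConstituentOf
            (P.finRep.smoothPart.toRepresentation.comp (inclPlace (↥(maximalRealSubfield L)) L (IsCMField.complexConj L) 3 H v)) ∧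
          c = IrrClass.comap (cmDatumLocalCongr L v T ha h).symm πn) → 𝔨.HasNComponent clsGp)
    (hPin_memEnv : ∀ (Pk : 𝔨.𝔊.Packet) (ξH : 𝔨.𝔊.PacketH), 𝔨.𝔊.IsAPacket Pk → 𝔨.IsOneDimH ξH → 𝔨.𝔊.liftsTo ξH Pk → 𝔨.𝔊.mem cls Pk →
      ∃ ξ' : OneDimAutRepH L, MemXiFamily P hH hHd μω hμu ξ') :
    -- (T) at this instance: the finite trigger routes `P` into SOME ξ′-envelope
    (∃ c : IrrClass ((cmDatum L 3 H).Local v),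
        (IrrClass.comap (localPiEquiv L (IsCMField.complexConj L) 3 H v) c).IsConstituentOf
            (P.finRep.smoothPart.toRepresentation.comp (inclPlace (↥(maximalRealSubfield L)) L (IsCMField.complexConj L) 3 H v)) ∧
          c = IrrClass.comap (cmDatumLocalCongr L v T ha h).symm πn) →
      ∃ ξ' : OneDimAutRepH L, MemXiFamily P hH hHd μω hμu ξ' := by
  intro htrig
  -- §15.3 ¶1 ∕ §13.10 p. 230: the `πⁿ`-component routes `P` to the germ of an A-packet `Π(ξ^)`, `ξ^` one-dimensional (five routing laws)
  obtain ⟨-, ξH, -, h1d, -, hgerm, -⟩ := nComponent_routesToAPacket_of_coreLaws 𝔨 hTri hPG hED hSX hEX clsGp hPin_mGp (hPin_n htrig)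
  -- §13.10 ¶3 ∕ Thm. 13.3.7: in that germ, `m(P) ≠ 0` forces membership in `Π(ξ^)` (seven core laws)
  obtain ⟨Pk, hA, hL, hmemPk⟩ := mem_aPacket_of_m_ne_zero_of_coreLaws 𝔨 h0 hT hE hS hCE hAL hLI ξH h1d (h1 ξH h1d)
  exact hPin_memEnv Pk ξH hA h1d hL (hmemPk cls (hPin_germGp.trans hgerm) hPin_m)

end Summit.HodgeConjecture.HodgeConjecture.R90.S5

end
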